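import Summits.CriticalPhenomena.SAWScalingLimit.Theorems.AvoidanceLimit.Negative.AvoidanceLimitKillCriteria

/-!
# Negative knowledge on crux `AvoidanceLimit`, part 7: lattice staircases and the endpoint transfer

Support file (refuter / cdisprove lane, cycle 3) for the crux
`Summit.CriticalPhenomena.SAWScalingLimit.Theses.SAWLoopFugacityFlow.AvoidanceLimit`
(stmt-CriticalPhenomena-10649). (i) `stair`: a monotone lattice staircase (first vertically towards
the real axis, then along it) joins any two mesh points of a set `W` stable under vertical shrinking
towards the axis and meeting the axis in an interval, all closed edges staying in `W`.
(ii) `isEndpointApprox_of_hull_of_axisCaps` (**ENDPOINT TRANSFER**): for a Dobrushin domain `D`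
with real marked points near which `D` has such "axis caps" (rectangles marked on vertical sides,
discs and ellipses marked at the ends of the horizontal axis, …), every endpoint approximation of
`D` IS one of each Dobrushin `D'` with the same marked points agreeing with `D` in balls around them
(the crux's inline hull hypotheses; `D' ⊆ D` is not needed): the staircases inside the caps
`D ∩ B(pt i, ε) ⊆ D'` bring `a_δ`, `b_δ` next to axis points of `D`, inside a fixed compact `K ⊆ D'`,
and the tree's theorem "the largest mesh component of a Jordan domain is the bulk"
(`JordanDomain.exists_forall_mem_meshDomain_and_reachable`) puts those sites in `Ω'_δ` and joins
them. Part 8 instantiates it on the reference square and on the unit disc. [folklore]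
-/

noncomputable section

open Set Filter Topology MeasureTheory Complex Metric
open UpperHalfPlane (upperHalfPlaneSet isOpen_upperHalfPlaneSet)
open Literature.Probability.RandomPlanarGeometry Literature.Probability.LatticeModels
open Summit.CriticalPhenomena.SAWScalingLimit.Theses.SAWLoopFugacityFlow (AvoidanceLimit)
open Summit.CriticalPhenomena.SAWScalingLimit.Theorems.IsingBoundaryRatio.Negative
  (mem_meshDomain_of_reachable_ne eventually_ne)
open scoped ENNReal

namespace Summit.CriticalPhenomena.SAWScalingLimit.Theorems.AvoidanceLimit.Negative

/-! ### Lattice staircases inside a cap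

A monotone lattice staircase (first vertically towards the real axis, then along it) joins any two
mesh points of a set `W` that is stable under vertical shrinking towards the axis and is an interval
on the axis; all intermediate closed edges stay in `W`. Used with the two caps
`D ∩ B(±2, ε) = {|z ∓ 2| < ε, ∓(Re z) > -2}` of the reference square `bigSq`. -/

section Staircase

variable {Ω W : Set ℂ} {δ : ℝ}

/-- Squared distance in `ℂ` in coordinates. [folklore] -/
theorem dist_sq_re_im (z w : ℂ) : dist z w ^ 2 = (z.re - w.re) ^ 2 + (z.im - w.im) ^ 2 := by
  rw [Complex.dist_eq, Complex.sq_norm, Complex.normSq_apply, Complex.sub_re, Complex.sub_im]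
  ring

/-- A vertical segment shrinking towards the axis stays in `W`. [folklore] -/
theorem segment_subset_of_vert
    (hvert : ∀ z ∈ W, ∀ w : ℂ, w.re = z.re → |w.im| ≤ |z.im| → w ∈ W)
    {p q : ℂ} (hp : p ∈ W) (hre : q.re = p.re) (him : |q.im| ≤ |p.im|) : segment ℝ p q ⊆ W := by
  rintro w ⟨s, t, hs, ht, hst, rfl⟩
  refine hvert p hp _ ?_ ?_
  · simp only [Complex.add_re, Complex.smul_re, smul_eq_mul, hre]
    rw [← add_mul, hst, one_mul]
  · simp only [Complex.add_im, Complex.smul_im, smul_eq_mul]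
    calc |s * p.im + t * q.im| ≤ |s * p.im| + |t * q.im| := abs_add_le _ _
      _ = s * |p.im| + t * |q.im| := by rw [abs_mul, abs_mul, abs_of_nonneg hs, abs_of_nonneg ht]
      _ ≤ s * |p.im| + t * |p.im| := by gcongr
      _ = |p.im| := by rw [← add_mul, hst, one_mul]

/-- A segment of the axis between two points of `W` stays in `W`. [folklore] -/
theorem segment_subset_of_hor
    (hhor : ∀ z₁ ∈ W, ∀ z₂ ∈ W, z₁.im = 0 → z₂.im = 0 →
      ∀ w : ℂ, w.im = 0 → z₁.re ≤ w.re → w.re ≤ z₂.re → w ∈ W)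
    {p q : ℂ} (hp : p ∈ W) (hq : q ∈ W) (hp0 : p.im = 0) (hq0 : q.im = 0) (hle : p.re ≤ q.re) :
    segment ℝ p q ⊆ W := by
  rintro w ⟨s, t, hs, ht, hst, rfl⟩
  have h1 := mul_le_mul_of_nonneg_left hle ht
  have h2 := mul_le_mul_of_nonneg_left hle hs
  obtain rfl : s = 1 - t := by linarith
  refine hhor p hp q hq hp0 hq0 _ ?_ ?_ ?_
  · simp [Complex.add_im, hp0, hq0]
  · simp only [Complex.add_re, Complex.smul_re, smul_eq_mul]
    linarith
  · simp only [Complex.add_re, Complex.smul_re, smul_eq_mul]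
    linarith

/-- One closed lattice edge inside `W ⊆ Ω` is an edge of the mesh graph on mesh vertices. [folklore] -/
theorem meshVertexGraph_adj_of (hWΩ : W ⊆ Ω) {x y : Site 2} (hx : meshPoint δ x ∈ W)
    (hy : meshPoint δ y ∈ W) (hzd : (zdGraph 2).Adj x y)
    (hseg : segment ℝ (meshPoint δ x) (meshPoint δ y) ⊆ W) :
    (meshVertexGraph Ω δ).Adj ⟨x, hWΩ hx⟩ ⟨y, hWΩ hy⟩ := by
  simp only [SimpleGraph.comap_adj, Function.Embedding.subtype_apply]
  exact meshGraph_adj_iff.2 ⟨hzd, (hseg.trans hWΩ).trans subset_closure⟩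

/-- **Vertical leg**: from a mesh point of `W` straight to the axis, inside `W`. [folklore] -/
theorem stair_vert (hWΩ : W ⊆ Ω) (hδ : 0 < δ)
    (hvert : ∀ z ∈ W, ∀ w : ℂ, w.re = z.re → |w.im| ≤ |z.im| → w ∈ W) :
    ∀ (n : ℕ) (c : ℤ) (x : Site 2), x 0 = c → (x 1).natAbs = n → meshPoint δ x ∈ W →
      ∃ (hx : x ∈ meshVertices Ω δ) (hy : (![c, 0] : Site 2) ∈ meshVertices Ω δ),
        (meshVertexGraph Ω δ).Reachable ⟨x, hx⟩ ⟨![c, 0], hy⟩ := by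
  intro n
  induction n with
  | zero =>
    intro c x hc hn hxW
    have h1 : x 1 = 0 := Int.natAbs_eq_zero.1 hn
    have heq : (![c, 0] : Site 2) = x := by
      funext i; fin_cases i
      · simp [hc]
      · simp [h1]
    refine ⟨hWΩ hxW, heq ▸ hWΩ hxW, ?_⟩
    have : (⟨![c, 0], heq ▸ hWΩ hxW⟩ : meshVertices Ω δ) = ⟨x, hWΩ hxW⟩ := Subtype.ext heq
    rw [this]
  | succ n ih =>
    intro c x hc hn hxW
    have hx1 : x 1 ≠ 0 := by
      intro h; rw [h] at hn; simp at hn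
    -- the next site towards the axis
    obtain hneg | hpos := lt_or_gt_of_ne hx1
    · set x' : Site 2 := x + Pi.single 1 1 with hx'def
      have hx'0 : x' 0 = c := by simp [hx'def, hc]
      have hx'1 : x' 1 = x 1 + 1 := by simp [hx'def]
      have hn' : (x' 1).natAbs = n := by omega
      have hre : (meshPoint δ x').re = (meshPoint δ x).re := by simp [meshPoint_re, hx'0, hc]
      have him : |(meshPoint δ x').im| ≤ |(meshPoint δ x).im| := by
        rw [meshPoint_im, meshPoint_im, hx'1, abs_mul, abs_mul, abs_of_pos hδ]
        push_cast
        have hle : ((x 1 : ℤ) : ℝ) ≤ -1 := by exact_mod_cast (show x 1 ≤ -1 by omega)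
        have h1 : |((x 1 : ℤ) : ℝ) + 1| ≤ |((x 1 : ℤ) : ℝ)| := by
          rw [abs_of_nonpos (by linarith), abs_of_nonpos (by linarith)]; linarith
        exact mul_le_mul_of_nonneg_left h1 hδ.le
      have hx'W : meshPoint δ x' ∈ W := hvert _ hxW _ hre him
      have hadj : (meshVertexGraph Ω δ).Adj ⟨x, hWΩ hxW⟩ ⟨x', hWΩ hx'W⟩ :=
        meshVertexGraph_adj_of hWΩ hxW hx'W ((zdGraph_adj_iff _ _).2 ⟨1, Or.inl rfl⟩)
          (segment_subset_of_vert hvert hxW hre him)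
      obtain ⟨_, hy, hreach⟩ := ih c x' hx'0 hn' hx'W
      exact ⟨hWΩ hxW, hy, hadj.reachable.trans hreach⟩
    · set x' : Site 2 := x - Pi.single 1 1 with hx'def
      have hx'0 : x' 0 = c := by simp [hx'def, hc]
      have hx'1 : x' 1 = x 1 - 1 := by simp [hx'def]
      have hn' : (x' 1).natAbs = n := by omega
      have hre : (meshPoint δ x').re = (meshPoint δ x).re := by simp [meshPoint_re, hx'0, hc]
      have him : |(meshPoint δ x').im| ≤ |(meshPoint δ x).im| := by
        rw [meshPoint_im, meshPoint_im, hx'1, abs_mul, abs_mul, abs_of_pos hδ]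
        push_cast
        have hle : (1 : ℝ) ≤ ((x 1 : ℤ) : ℝ) := by exact_mod_cast (show 1 ≤ x 1 by omega)
        have h1 : |((x 1 : ℤ) : ℝ) - 1| ≤ |((x 1 : ℤ) : ℝ)| := by
          rw [abs_of_nonneg (by linarith), abs_of_nonneg (by linarith)]; linarith
        exact mul_le_mul_of_nonneg_left h1 hδ.le
      have hx'W : meshPoint δ x' ∈ W := hvert _ hxW _ hre him
      have hadj : (meshVertexGraph Ω δ).Adj ⟨x, hWΩ hxW⟩ ⟨x', hWΩ hx'W⟩ :=
        meshVertexGraph_adj_of hWΩ hxW hx'W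
          ((zdGraph_adj_iff _ _).2 ⟨1, Or.inr (by simp [hx'def])⟩)
          (segment_subset_of_vert hvert hxW hre him)
      obtain ⟨_, hy, hreach⟩ := ih c x' hx'0 hn' hx'W
      exact ⟨hWΩ hxW, hy, hadj.reachable.trans hreach⟩

/-- **Horizontal leg**: along the axis between two mesh points of `W`, inside `W`. [folklore] -/
theorem stair_hor (hWΩ : W ⊆ Ω) (hδ : 0 < δ)
    (hhor : ∀ z₁ ∈ W, ∀ z₂ ∈ W, z₁.im = 0 → z₂.im = 0 →
      ∀ w : ℂ, w.im = 0 → z₁.re ≤ w.re → w.re ≤ z₂.re → w ∈ W) :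
    ∀ (n : ℕ) (i j : ℤ), i ≤ j → (j - i).toNat = n →
      meshPoint δ ![i, 0] ∈ W → meshPoint δ ![j, 0] ∈ W →
      ∃ (hx : (![i, 0] : Site 2) ∈ meshVertices Ω δ) (hy : (![j, 0] : Site 2) ∈ meshVertices Ω δ),
        (meshVertexGraph Ω δ).Reachable ⟨![i, 0], hx⟩ ⟨![j, 0], hy⟩ := by
  intro n
  induction n with
  | zero =>
    intro i j hij hn hiW hjW
    have : j = i := by omega
    subst this
    exact ⟨hWΩ hiW, hWΩ hjW, SimpleGraph.Reachable.refl _⟩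
  | succ n ih =>
    intro i j hij hn hiW hjW
    have hlt : i + 1 ≤ j := by omega
    have hn' : (j - (i + 1)).toNat = n := by omega
    have him0 : ∀ k : ℤ, (meshPoint δ ![k, 0]).im = 0 := fun k ↦ by simp [meshPoint_im]
    have hre : ∀ k : ℤ, (meshPoint δ ![k, 0]).re = δ * k := fun k ↦ by simp [meshPoint_re]
    have hi'W : meshPoint δ ![i + 1, 0] ∈ W := by
      refine hhor _ hiW _ hjW (him0 i) (him0 j) _ (him0 _) ?_ ?_
      · rw [hre, hre]; push_cast; nlinarith
      · rw [hre, hre]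
        have : ((i + 1 : ℤ) : ℝ) ≤ j := by exact_mod_cast hlt
        nlinarith
    have hzd : (zdGraph 2).Adj (![i, 0] : Site 2) ![i + 1, 0] := by
      refine (zdGraph_adj_iff _ _).2 ⟨0, Or.inl ?_⟩
      funext k; fin_cases k <;> simp
    have hseg : segment ℝ (meshPoint δ ![i, 0]) (meshPoint δ ![i + 1, 0]) ⊆ W :=
      segment_subset_of_hor hhor hiW hi'W (him0 i) (him0 _)
        (by rw [hre, hre]; push_cast; nlinarith)
    have hadj := meshVertexGraph_adj_of hWΩ hiW hi'W hzd hseg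
    obtain ⟨_, hy, hreach⟩ := ih (i + 1) j hlt hn' hi'W hjW
    exact ⟨hWΩ hiW, hy, hadj.reachable.trans hreach⟩

/-- **The staircase**: any two mesh points of `W` are joined in the mesh graph of `Ω ⊇ W` on mesh
vertices, through `W`. [folklore] -/
theorem stair (hWΩ : W ⊆ Ω) (hδ : 0 < δ)
    (hvert : ∀ z ∈ W, ∀ w : ℂ, w.re = z.re → |w.im| ≤ |z.im| → w ∈ W)
    (hhor : ∀ z₁ ∈ W, ∀ z₂ ∈ W, z₁.im = 0 → z₂.im = 0 →
      ∀ w : ℂ, w.im = 0 → z₁.re ≤ w.re → w.re ≤ z₂.re → w ∈ W)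
    {x y : Site 2} (hx : meshPoint δ x ∈ W) (hy : meshPoint δ y ∈ W) :
    ∃ (hx' : x ∈ meshVertices Ω δ) (hy' : y ∈ meshVertices Ω δ),
      (meshVertexGraph Ω δ).Reachable ⟨x, hx'⟩ ⟨y, hy'⟩ := by
  have hfoot : ∀ z : Site 2, meshPoint δ z ∈ W → meshPoint δ ![z 0, 0] ∈ W := fun z hz ↦
    hvert _ hz _ (by simp [meshPoint_re]) (by simp [meshPoint_im]; positivity)
  obtain ⟨_, hx0, hX⟩ := stair_vert hWΩ hδ hvert _ (x 0) x rfl rfl hx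
  obtain ⟨_, hy0, hY⟩ := stair_vert hWΩ hδ hvert _ (y 0) y rfl rfl hy
  rcases le_total (x 0) (y 0) with hle | hle
  · obtain ⟨_, _, hH⟩ := stair_hor hWΩ hδ hhor _ (x 0) (y 0) hle rfl (hfoot x hx) (hfoot y hy)
    exact ⟨hWΩ hx, hWΩ hy, (hX.trans hH).trans hY.symm⟩
  · obtain ⟨_, _, hH⟩ := stair_hor hWΩ hδ hhor _ (y 0) (x 0) hle rfl (hfoot y hy) (hfoot x hx)
    exact ⟨hWΩ hx, hWΩ hy, (hX.trans hH.symm).trans hY.symm⟩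

end Staircase


/-! ### The endpoint transfer for domains with axis caps at the marked points -/

section Transfer

/-- The mesh point of the lattice site `(round (c/δ), 0)` is within `δ/2` of the real point `c`.
[folklore] -/
theorem dist_meshPoint_round_le {δ : ℝ} (hδ : 0 < δ) (c : ℝ) :
    dist (meshPoint δ ![round (c / δ), 0]) (c : ℂ) ≤ δ / 2 := by
  have hre : (meshPoint δ ![round (c / δ), 0]).re = δ * round (c / δ) := by simp [meshPoint_re]
  have him : (meshPoint δ ![round (c / δ), 0]).im = 0 := by simp [meshPoint_im]
  have key : |δ * round (c / δ) - c| ≤ δ / 2 := by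
    have h := abs_sub_round (c / δ)
    have : δ * round (c / δ) - c = -(δ * (c / δ - round (c / δ))) := by field_simp; ring
    rw [this, abs_neg, abs_mul, abs_of_pos hδ]
    calc δ * |c / δ - round (c / δ)| ≤ δ * (1 / 2) := by gcongr
      _ = δ / 2 := by ring
  have h2 : dist (meshPoint δ ![round (c / δ), 0]) (c : ℂ) ^ 2 ≤ (δ / 2) ^ 2 := by
    rw [dist_sq_re_im, hre, him]
    simp only [Complex.ofReal_re, Complex.ofReal_im, sub_zero]
    nlinarith [sq_abs (δ * round (c / δ) - c), abs_nonneg (δ * round (c / δ) - c)]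
  exact le_of_pow_le_pow_left₀ two_ne_zero (by positivity) h2

/-- Vertical stability towards the real axis passes to the intersection with a ball about a real
point (the distance to a real point decreases with `|Im|` at fixed `Re`). [folklore] -/
theorem vertStable_inter_ball {W : Set ℂ} {p : ℂ} (hp : p.im = 0) (ε : ℝ)
    (hW : ∀ z ∈ W, ∀ w : ℂ, w.re = z.re → |w.im| ≤ |z.im| → w ∈ W) :
    ∀ z ∈ W ∩ ball p ε, ∀ w : ℂ, w.re = z.re → |w.im| ≤ |z.im| → w ∈ W ∩ ball p ε := by
  rintro z ⟨hzW, hzb⟩ w hre him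
  refine ⟨hW z hzW w hre him, ?_⟩
  rw [mem_ball] at hzb ⊢
  have hz2 := pow_lt_pow_left₀ hzb dist_nonneg two_ne_zero
  refine lt_of_pow_lt_pow_left₀ 2 (le_of_lt (lt_of_le_of_lt dist_nonneg hzb)) ?_
  rw [dist_sq_re_im] at hz2 ⊢
  rw [hre, hp] at *
  nlinarith [sq_abs w.im, sq_abs z.im, abs_nonneg w.im,
    mul_le_mul him him (abs_nonneg _) (abs_nonneg _)]

/-- The interval property on the axis passes to the intersection with a ball about a real point.
[folklore] -/
theorem axisInterval_inter_ball {W : Set ℂ} {p : ℂ} (hp : p.im = 0) (ε : ℝ)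
    (hW : ∀ z₁ ∈ W, ∀ z₂ ∈ W, z₁.im = 0 → z₂.im = 0 →
      ∀ w : ℂ, w.im = 0 → z₁.re ≤ w.re → w.re ≤ z₂.re → w ∈ W) :
    ∀ z₁ ∈ W ∩ ball p ε, ∀ z₂ ∈ W ∩ ball p ε, z₁.im = 0 → z₂.im = 0 →
      ∀ w : ℂ, w.im = 0 → z₁.re ≤ w.re → w.re ≤ z₂.re → w ∈ W ∩ ball p ε := by
  rintro z₁ ⟨h₁W, h₁b⟩ z₂ ⟨h₂W, h₂b⟩ h₁ h₂ w hw hle₁ hle₂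
  refine ⟨hW z₁ h₁W z₂ h₂W h₁ h₂ w hw hle₁ hle₂, ?_⟩
  rw [mem_ball] at h₁b h₂b ⊢
  have hε : 0 < ε := lt_of_le_of_lt dist_nonneg h₁b
  have e₁ := pow_lt_pow_left₀ h₁b dist_nonneg two_ne_zero
  have e₂ := pow_lt_pow_left₀ h₂b dist_nonneg two_ne_zero
  refine lt_of_pow_lt_pow_left₀ 2 hε.le ?_
  rw [dist_sq_re_im] at e₁ e₂ ⊢
  rw [hw, h₁, h₂, hp] at *
  -- `(w.re - p.re)^2 ≤ max ((z₁.re - p.re)^2) ((z₂.re - p.re)^2)` since `w.re ∈ [z₁.re, z₂.re]`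
  by_cases hwp : w.re ≤ p.re
  · nlinarith
  · push Not at hwp
    nlinarith

/-- **ENDPOINT TRANSFER for domains with axis caps.** Let `(D; a, b)` have both marked points on
the real axis, near each of which `D` is stable under vertical shrinking towards the axis and meets
the axis in an interval accumulating at the marked point (true for rectangles marked at midpoints of
vertical sides, discs and ellipses marked at the ends of the horizontal axis, stadiums, …). Then every
endpoint approximation of `D` is one of each Dobrushin `D'` with the same marked points agreeing with
`D` in balls around them (the crux's inline hull hypotheses; `D' ⊆ D` is not needed): for small `δ`,
`a_δ` and `b_δ` lie in the largest mesh component `Ω'_δ` of `D'` and are joined there. Proof: lattice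
staircases (`stair`) inside the caps `D ∩ B(pt i, ε) ⊆ D'` bring `a_δ`, `b_δ` next to axis points
`cᵢ ∈ D` near the marked points, inside a fixed compact `K ⊆ D'` (two closed discs about `c₀, c₁`),
and the tree's theorem "the largest mesh component of a Jordan domain is the bulk"
(`JordanDomain.exists_forall_mem_meshDomain_and_reachable`) puts those sites in `Ω'_δ` and joins
them. [folklore] -/
theorem isEndpointApprox_of_hull_of_axisCaps {D D' : DobrushinDomain} {a b : ℝ → Site 2}
    (hab : SAW.IsEndpointApprox D a b) (h0 : D'.pt 0 = D.pt 0) (h1 : D'.pt 1 = D.pt 1)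
    (hball : ∃ ε : ℝ, 0 < ε ∧ D'.carrier ∩ ball (D.pt 0) ε = D.carrier ∩ ball (D.pt 0) ε ∧
      D'.carrier ∩ ball (D.pt 1) ε = D.carrier ∩ ball (D.pt 1) ε)
    (hreal : ∀ i : Fin 2, (D.pt i).im = 0)
    (hvert : ∃ ε₀ : ℝ, 0 < ε₀ ∧ ∀ i : Fin 2, ∀ z ∈ D.carrier ∩ ball (D.pt i) ε₀, ∀ w : ℂ,
      w.re = z.re → |w.im| ≤ |z.im| → w ∈ D.carrier ∩ ball (D.pt i) ε₀)
    (hhor : ∃ ε₀ : ℝ, 0 < ε₀ ∧ ∀ i : Fin 2, ∀ z₁ ∈ D.carrier ∩ ball (D.pt i) ε₀,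
      ∀ z₂ ∈ D.carrier ∩ ball (D.pt i) ε₀, z₁.im = 0 → z₂.im = 0 →
      ∀ w : ℂ, w.im = 0 → z₁.re ≤ w.re → w.re ≤ z₂.re → w ∈ D.carrier ∩ ball (D.pt i) ε₀)
    (haxis : ∀ i : Fin 2, ∀ ε : ℝ, 0 < ε → ∃ x : ℝ, (x : ℂ) ∈ D.carrier ∧ dist (x : ℂ) (D.pt i) < ε) :
    SAW.IsEndpointApprox D' a b := by
  obtain ⟨εb, hεb, hb0, hb1⟩ := hball
  obtain ⟨εv, hεv, hv⟩ := hvert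
  obtain ⟨εh, hεh, hh⟩ := hhor
  -- one radius for everything
  set ε : ℝ := min εb (min εv εh) with hεdef
  have hε : 0 < ε := lt_min hεb (lt_min hεv hεh)
  have hεb' : ε ≤ εb := min_le_left _ _
  have hεv' : ε ≤ εv := (min_le_right _ _).trans (min_le_left _ _)
  have hεh' : ε ≤ εh := (min_le_right _ _).trans (min_le_right _ _)
  have hagree : ∀ i : Fin 2, D'.carrier ∩ ball (D.pt i) εb = D.carrier ∩ ball (D.pt i) εb := by
    intro i; fin_cases i
    · exact hb0
    · exact hb1
  -- the caps `W i = D ∩ B(pt i, ε)`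
  set W : Fin 2 → Set ℂ := fun i ↦ D.carrier ∩ ball (D.pt i) ε with hWdef
  have hWD' : ∀ i, W i ⊆ D'.carrier := by
    rintro i z ⟨hzD, hzb⟩
    have : z ∈ D'.carrier ∩ ball (D.pt i) εb := by
      rw [hagree i]; exact ⟨hzD, ball_subset_ball hεb' hzb⟩
    exact this.1
  have hWv : ∀ i, ∀ z ∈ W i, ∀ w : ℂ, w.re = z.re → |w.im| ≤ |z.im| → w ∈ W i := by
    intro i
    have hsub : W i = (D.carrier ∩ ball (D.pt i) εv) ∩ ball (D.pt i) ε := by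
      rw [hWdef, inter_assoc, inter_eq_right.2 (ball_subset_ball hεv')]
    rw [hsub]
    exact vertStable_inter_ball (hreal i) ε (hv i)
  have hWh : ∀ i, ∀ z₁ ∈ W i, ∀ z₂ ∈ W i, z₁.im = 0 → z₂.im = 0 →
      ∀ w : ℂ, w.im = 0 → z₁.re ≤ w.re → w.re ≤ z₂.re → w ∈ W i := by
    intro i
    have hsub : W i = (D.carrier ∩ ball (D.pt i) εh) ∩ ball (D.pt i) ε := by
      rw [hWdef, inter_assoc, inter_eq_right.2 (ball_subset_ball hεh')]
    rw [hsub]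
    exact axisInterval_inter_ball (hreal i) ε (hh i)
  -- axis points `c i ∈ D` near the marked points, with closed discs inside the caps
  have hc : ∀ i : Fin 2, ∃ c : ℝ, ∃ ρ : ℝ, 0 < ρ ∧ closedBall (c : ℂ) ρ ⊆ W i := by
    intro i
    obtain ⟨c, hcD, hcd⟩ := haxis i (ε / 2) (half_pos hε)
    obtain ⟨r, hr, hrD⟩ := Metric.isOpen_iff.1 D.isOpen (c : ℂ) hcD
    refine ⟨c, min (r / 2) (ε / 4), lt_min (half_pos hr) (by positivity), fun z hz ↦ ⟨?_, ?_⟩⟩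
    · exact hrD (mem_ball.2 (lt_of_le_of_lt (mem_closedBall.1 hz)
        (lt_of_le_of_lt (min_le_left _ _) (half_lt_self hr))))
    · rw [mem_ball]
      calc dist z (D.pt i) ≤ dist z (c : ℂ) + dist (c : ℂ) (D.pt i) := dist_triangle _ _ _
        _ < ε / 4 + ε / 2 := add_lt_add_of_le_of_lt
            ((mem_closedBall.1 hz).trans (min_le_right _ _)) hcd
        _ < ε := by linarith
  choose c ρ hρ hcW using hc
  set K : Set ℂ := closedBall (c 0 : ℂ) (ρ 0) ∪ closedBall (c 1 : ℂ) (ρ 1) with hKdef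
  have hKc : IsCompact K := (isCompact_closedBall _ _).union (isCompact_closedBall _ _)
  have hKD' : K ⊆ D'.carrier := union_subset ((hcW 0).trans (hWD' 0)) ((hcW 1).trans (hWD' 1))
  obtain ⟨δ₀, hδ₀, hgood⟩ :=
    D'.toJordanDomain.exists_forall_mem_meshDomain_and_reachable hKc hKD'
  refine ⟨?_, by rw [h0]; exact hab.tendsto_fst, by rw [h1]; exact hab.tendsto_snd⟩
  have hA : ∀ᶠ δ in 𝓝[>] (0 : ℝ), meshPoint δ (a δ) ∈ ball (D.pt 0) ε :=
    hab.tendsto_fst (ball_mem_nhds _ hε)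
  have hB : ∀ᶠ δ in 𝓝[>] (0 : ℝ), meshPoint δ (b δ) ∈ ball (D.pt 1) ε :=
    hab.tendsto_snd (ball_mem_nhds _ hε)
  have hρ01 : 0 < min (ρ 0) (ρ 1) := lt_min (hρ 0) (hρ 1)
  filter_upwards [hab.reachable, hA, hB, Ioo_mem_nhdsGT (lt_min hδ₀ hρ01)] with δ hr ha hb hδ
  obtain ⟨hδpos, hδlt⟩ := hδ
  have hδ₀' : δ < δ₀ := hδlt.trans_le (min_le_left _ _)
  have hδρ : ∀ i, δ < ρ i := by
    intro i; fin_cases i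
    · exact hδlt.trans_le ((min_le_right _ _).trans (min_le_left _ _))
    · exact hδlt.trans_le ((min_le_right _ _).trans (min_le_right _ _))
  by_cases heq : a δ = b δ
  · rw [heq]
  -- the endpoints are vertices of `Ω_δ`, so their mesh points lie in `D`, hence in the caps
  have haD : a δ ∈ meshDomain D.carrier δ := mem_meshDomain_of_reachable_ne hr heq
  have hbD : b δ ∈ meshDomain D.carrier δ := mem_meshDomain_of_reachable_ne hr.symm (Ne.symm heq)
  have haW : meshPoint δ (a δ) ∈ W 0 := ⟨meshDomain_subset_meshVertices _ _ haD, ha⟩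
  have hbW : meshPoint δ (b δ) ∈ W 1 := ⟨meshDomain_subset_meshVertices _ _ hbD, hb⟩
  -- the anchor sites next to `c i`
  set k : Fin 2 → Site 2 := fun i ↦ ![round (c i / δ), 0] with hkdef
  have hkd : ∀ i, dist (meshPoint δ (k i)) (c i : ℂ) ≤ δ / 2 := fun i ↦
    dist_meshPoint_round_le hδpos (c i)
  have hkball : ∀ i, meshPoint δ (k i) ∈ closedBall (c i : ℂ) (ρ i) := fun i ↦
    mem_closedBall.2 ((hkd i).trans (by linarith [hδρ i]))
  have hkK : ∀ i, meshPoint δ (k i) ∈ K := by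
    intro i; fin_cases i
    · exact Or.inl (hkball 0)
    · exact Or.inr (hkball 1)
  have hkW : ∀ i, meshPoint δ (k i) ∈ W i := fun i ↦ hcW i (hkball i)
  obtain ⟨hin, hconn⟩ := hgood δ hδpos hδ₀'
  have hkdom : ∀ i, k i ∈ meshDomain D'.carrier δ := fun i ↦ hin (k i) (hkK i)
  -- staircases inside the caps, then the bulk theorem
  obtain ⟨_, _, hreach0⟩ := stair (hWD' 0) hδpos (hWv 0) (hWh 0) haW (hkW 0)
  obtain ⟨_, _, hreach1⟩ := stair (hWD' 1) hδpos (hWv 1) (hWh 1) hbW (hkW 1)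
  obtain ⟨p0⟩ := hreach0.symm
  obtain ⟨p1⟩ := hreach1.symm
  have h1' : (discreteDomainGraph D'.carrier δ).Reachable (k 0) (a δ) :=
    reachable_discreteDomainGraph_of_walk p0 (hkdom 0)
  have h2' : (discreteDomainGraph D'.carrier δ).Reachable (k 1) (b δ) :=
    reachable_discreteDomainGraph_of_walk p1 (hkdom 1)
  obtain ⟨_, _, ⟨pK⟩⟩ := hconn (k 0) (hkdom 0) (k 1) (hkdom 1)
  have h3' : (discreteDomainGraph D'.carrier δ).Reachable (k 0) (k 1) :=
    reachable_discreteDomainGraph_of_walk pK (hkdom 0)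
  exact h1'.symm.trans (h3'.trans h2')

end Transfer

end Summit.CriticalPhenomena.SAWScalingLimit.Theorems.AvoidanceLimit.Negative

end
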